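import Mathlib
import Summits.Ventures.PercRepro2.CrossAPrimeA1VMid

/-!
# The support of a weight vector, re-rooting, and loops — tools for the induction on the random edges
(blind cell PercRepro2, p5 g32; `proofs/P5-OEDGE.md` §42 (14), S4 §2.4 (s) addendum 20 (14))

`supp p` = the configurations compatible with the sure (`p e = 1`) and the null (`p e = 0`) edges;
a probability only sees the support (`prob_congr_supp`). `sureConfig p` = the sure edges as a
configuration; `crossA'so_congr_supp` / **`crossA'so_reroot`**: the masses of `crossA′so` only see
the events on the support, so the root `a₁` may be replaced by any `t` with `a₁ ↔ t` sure.
**`crossA'so_update_loop`**: a loop edge is free. Own work; standard axioms.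
-/

namespace Summit.Ventures.PercRepro2

open LeafRowPendantRootSO CrossAPrimeA1VMid

namespace CrossAPrimeSupport

section Support

variable {E : Type*} [Fintype E] [DecidableEq E] {R : Type*} [CommRing R]

/-- The configurations compatible with the sure (`p e = 1`) and the null (`p e = 0`) edges. -/
def supp (p : E → R) : Set (Config E) :=
  {ω | ∀ e, (p e = 1 → ω e = true) ∧ (p e = 0 → ω e = false)}

omit [DecidableEq E] in
/-- A configuration outside the support has weight `0`. -/
lemma weight_eq_zero_of_not_mem_supp (p : E → R) {ω : Config E} (h : ω ∉ supp p) :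
    weight p ω = 0 := by
  simp only [supp, Set.mem_setOf_eq] at h
  obtain ⟨e, he⟩ := not_forall.1 h
  rw [not_and_or] at he
  unfold weight
  apply Finset.prod_eq_zero (Finset.mem_univ e)
  rcases he with he | he
  · rw [Classical.not_imp] at he
    obtain ⟨h1, h2⟩ := he
    cases hb : ω e with
    | true => exact absurd hb h2
    | false => rw [h1]; simp
  · rw [Classical.not_imp] at he
    obtain ⟨h1, h2⟩ := he
    cases hb : ω e with
    | true => rw [h1]; simp
    | false => exact absurd hb h2

/-- A probability only sees the support. -/
lemma prob_inter_supp (p : E → R) (X : Set (Config E)) : prob p (X ∩ supp p) = prob p X := by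
  unfold prob
  refine Finset.sum_congr rfl fun ω _ => ?_
  by_cases hω : ω ∈ supp p
  · by_cases hX : ω ∈ X
    · rw [Set.indicator_of_mem (Set.mem_inter hX hω), Set.indicator_of_mem hX]
    · rw [Set.indicator_of_notMem (fun h => hX h.1), Set.indicator_of_notMem hX]
  · rw [Set.indicator_of_notMem (fun h => hω h.2)]
    by_cases hX : ω ∈ X
    · rw [Set.indicator_of_mem hX, weight_eq_zero_of_not_mem_supp p hω]
    · rw [Set.indicator_of_notMem hX]

/-- Events that agree on the support have the same probability. -/
lemma prob_congr_supp (p : E → R) {X Y : Set (Config E)} (h : X ∩ supp p = Y ∩ supp p) :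
    prob p X = prob p Y := by
  rw [← prob_inter_supp p X, h, prob_inter_supp]

open scoped Classical in
/-- The configuration of the sure edges. -/
noncomputable def sureConfig (p : E → R) : Config E := fun e => decide (p e = 1)

omit [Fintype E] [DecidableEq E] in
/-- On the support every sure edge is open. -/
lemma sureConfig_le_of_mem_supp (p : E → R) {ω : Config E} (hω : ω ∈ supp p) :
    sureConfig p ≤ ω := by
  intro e
  simp only [sureConfig]
  by_cases h : p e = 1
  · rw [(hω e).1 h]
    simp
  · simp [h]

omit [Fintype E] in
/-- Pinning a non-sure edge closed does not change the sure configuration. -/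
lemma sureConfig_update_zero [Nontrivial R] (p : E → R) {e : E} (h1 : p e ≠ 1) :
    sureConfig (Function.update p e 0) = sureConfig p := by
  funext f
  simp only [sureConfig]
  by_cases hf : f = e
  · subst hf
    simp [h1]
  · simp [Function.update_of_ne hf]

/-- A set-algebra helper: intersections of events that agree on a set `S` agree on `S`. -/
lemma inter_inter_congr {α : Type*} {A A' B B' S : Set α} (hA : A ∩ S = A' ∩ S)
    (hB : B ∩ S = B' ∩ S) : (A ∩ B) ∩ S = (A' ∩ B') ∩ S := by
  ext ω
  have h1 : ω ∈ A ∩ S ↔ ω ∈ A' ∩ S := by rw [hA]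
  have h2 : ω ∈ B ∩ S ↔ ω ∈ B' ∩ S := by rw [hB]
  simp only [Set.mem_inter_iff] at h1 h2 ⊢
  tauto

end Support

section Reroot

variable {V : Type*} {E : Type*} [Fintype E] [DecidableEq E] [Fintype V] [DecidableEq V]
  {R : Type*} [Field R] [LinearOrder R] [IsStrictOrderedRing R]
variable {ends : E → Sym2 V}

omit [Fintype E] [DecidableEq E] [Fintype V] [DecidableEq V] [LinearOrder R]
  [IsStrictOrderedRing R] in
/-- A sure connection holds on the support. -/
lemma conn_of_mem_supp {p : E → R} {ω : Config E} (hω : ω ∈ supp p) {x y : V}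
    (h : Conn ends (sureConfig p) x y) : Conn ends ω x y :=
  conn_mono (sureConfig_le_of_mem_supp p hω) h

omit [Fintype E] [DecidableEq E] [Fintype V] [DecidableEq V] [LinearOrder R]
  [IsStrictOrderedRing R] in
/-- On the support, `{a₂ ↮ a₁}` is `{a₂ ↮ t}` when `a₁ ↔ t` is sure. -/
lemma avoid_inter_supp_eq (p : E → R) {a₁ t : V} (ht : Conn ends (sureConfig p) a₁ t)
    (a₂ : V) : avoidAll ends a₂ {a₁} ∩ supp p = avoidAll ends a₂ {t} ∩ supp p := by
  ext ω
  simp only [Set.mem_inter_iff, mem_avoidAll, Finset.mem_singleton, forall_eq]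
  constructor
  · rintro ⟨h1, hω⟩
    exact ⟨fun hc => h1 (conn_trans hc (conn_symm (conn_of_mem_supp hω ht))), hω⟩
  · rintro ⟨h1, hω⟩
    exact ⟨fun hc => h1 (conn_trans hc (conn_of_mem_supp hω ht)), hω⟩

omit [Fintype E] [DecidableEq E] [Fintype V] [DecidableEq V] [LinearOrder R]
  [IsStrictOrderedRing R] in
/-- On the support, `{v ∈ C(a₁)}` is `{v ∈ C(t)}` when `a₁ ↔ t` is sure. -/
lemma connEvent_inter_supp_eq (p : E → R) {a₁ t : V} (ht : Conn ends (sureConfig p) a₁ t)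
    (v : V) : connEvent ends a₁ v ∩ supp p = connEvent ends t v ∩ supp p := by
  ext ω
  simp only [Set.mem_inter_iff, connEvent, Set.mem_setOf_eq]
  constructor
  · rintro ⟨h1, hω⟩
    exact ⟨conn_trans (conn_symm (conn_of_mem_supp hω ht)) h1, hω⟩
  · rintro ⟨h1, hω⟩
    exact ⟨conn_trans (conn_of_mem_supp hω ht) h1, hω⟩

omit [Fintype V] [DecidableEq V] [LinearOrder R] [IsStrictOrderedRing R] in
/-- **The masses only see the support**: `crossA′so` with `Q` and `vL` replaced by events that agree
with them on `supp p`. -/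
theorem crossA'so_congr_supp (p : E → R) (o a₁ a₂ v b : V) {Q' L' : Set (Config E)}
    (hQ : avoidAll ends a₂ {a₁} ∩ supp p = Q' ∩ supp p)
    (hv : connEvent ends a₁ v ∩ supp p = L' ∩ supp p) :
    crossA'so p ends o a₁ a₂ v b =
      2 * prob p Q' * prob p (Q' ∩ (L' ∩ (connEvent ends a₂ o ∩ connEvent ends a₂ b))) -
        prob p (Q' ∩ connEvent ends a₂ b) * prob p (Q' ∩ (L' ∩ connEvent ends a₂ o)) +
        prob p L' * prob p (Q' ∩ connEvent ends a₂ o) * prob p (Q' ∩ connEvent ends a₂ b) -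
        prob p (Q' ∩ connEvent ends a₂ o) * prob p (Q' ∩ (L' ∩ connEvent ends a₂ b)) := by
  have e1 := prob_congr_supp p hQ
  have e2 := prob_congr_supp p hv
  have e3 := prob_congr_supp p (inter_inter_congr hQ (inter_inter_congr hv
    (rfl : (connEvent ends a₂ o ∩ connEvent ends a₂ b) ∩ supp p = _)))
  have e4 := prob_congr_supp p (inter_inter_congr hQ (rfl : connEvent ends a₂ b ∩ supp p = _))
  have e5 := prob_congr_supp p (inter_inter_congr hQ (inter_inter_congr hv
    (rfl : connEvent ends a₂ o ∩ supp p = _)))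
  have e6 := prob_congr_supp p (inter_inter_congr hQ (rfl : connEvent ends a₂ o ∩ supp p = _))
  have e7 := prob_congr_supp p (inter_inter_congr hQ (inter_inter_congr hv
    (rfl : connEvent ends a₂ b ∩ supp p = _)))
  unfold crossA'so
  rw [e1, e2, e3, e4, e5, e6, e7]

omit [Fintype V] [DecidableEq V] [LinearOrder R] [IsStrictOrderedRing R] in
/-- **Re-rooting**: `crossA′so` with root `a₁` equals `crossA′so` with root `t` when `a₁ ↔ t` is
sure (a weight-1 path). -/
theorem crossA'so_reroot (p : E → R) {a₁ t : V} (ht : Conn ends (sureConfig p) a₁ t)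
    (o a₂ v b : V) : crossA'so p ends o a₁ a₂ v b = crossA'so p ends o t a₂ v b :=
  crossA'so_congr_supp p o a₁ a₂ v b (avoid_inter_supp_eq (R := R) p ht a₂)
    (connEvent_inter_supp_eq (R := R) p ht v)

end Reroot

section Loop

variable {V : Type*} {E : Type*} [Fintype E] [DecidableEq E] [DecidableEq V] {R : Type*}
  [Field R] [LinearOrder R] [IsStrictOrderedRing R]
variable {ends : E → Sym2 V}

omit [Fintype E] [DecidableEq V] in
/-- A loop never carries an adjacency. -/
lemma openGraph_update_loop {e : E} {t : V} (hl : ends e = s(t, t)) (ω : Config E) (c : Bool) :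
    openGraph ends (Function.update ω e c) = openGraph ends ω := by
  ext u w
  rw [openGraph_adj, openGraph_adj]
  constructor
  · rintro ⟨huw, f, hf, hends⟩
    refine ⟨huw, f, ?_, hends⟩
    by_cases hfe : f = e
    · subst hfe
      rw [hl] at hends
      exact absurd ((Sym2.eq_iff.1 hends).elim (fun h => h.1.symm.trans h.2)
        (fun h => h.2.symm.trans h.1)) huw
    · rwa [Function.update_of_ne hfe] at hf
  · rintro ⟨huw, f, hf, hends⟩
    refine ⟨huw, f, ?_, hends⟩
    by_cases hfe : f = e
    · subst hfe
      rw [hl] at hends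
      exact absurd ((Sym2.eq_iff.1 hends).elim (fun h => h.1.symm.trans h.2)
        (fun h => h.2.symm.trans h.1)) huw
    · rwa [Function.update_of_ne hfe]

omit [Fintype E] [DecidableEq V] in
/-- Connection does not see a loop. -/
lemma conn_update_loop {e : E} {t : V} (hl : ends e = s(t, t)) (ω : Config E) (c : Bool)
    (x y : V) : Conn ends (Function.update ω e c) x y ↔ Conn ends ω x y := by
  unfold Conn
  rw [openGraph_update_loop hl]

omit [LinearOrder R] [IsStrictOrderedRing R] in
/-- Pinning an edge closed does not change the probability of an event invariant under closing
it. -/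
lemma prob_update_zero_loop (e : E) (p : E → R)
    (X : Set (Config E)) (hX : ∀ ω, Function.update ω e false ∈ X ↔ ω ∈ X) :
    prob (Function.update p e 0) X = prob p X := by
  rw [RBRootEdge.prob_update_zero_eq]
  congr 1
  ext ω
  exact hX ω

omit [Fintype E] [DecidableEq V] in
/-- `avoidAll` is invariant under a loop pin. -/
lemma update_loop_mem_iff {e : E} {t : V} (hl : ends e = s(t, t)) (a₂ : V) (X : Finset V)
    (ω : Config E) : Function.update ω e false ∈ avoidAll ends a₂ X ↔ ω ∈ avoidAll ends a₂ X := by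
  simp only [mem_avoidAll]
  exact forall_congr' fun x => imp_congr_right fun _ => not_congr (conn_update_loop hl ω false a₂ x)

omit [Fintype E] [DecidableEq V] in
/-- `connEvent` is invariant under a loop pin. -/
lemma update_loop_mem_connEvent_iff {e : E} {t : V} (hl : ends e = s(t, t)) (x y : V)
    (ω : Config E) : Function.update ω e false ∈ connEvent ends x y ↔ ω ∈ connEvent ends x y :=
  conn_update_loop hl ω false x y

omit [DecidableEq V] [LinearOrder R] [IsStrictOrderedRing R] in
/-- **A random loop is free**: `crossA′so(p) = crossA′so(p[e ↦ 0])` for a loop `e`. -/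
theorem crossA'so_update_loop {e : E} {t : V} (hl : ends e = s(t, t)) (p : E → R)
    (o a₁ a₂ v b : V) :
    crossA'so (Function.update p e 0) ends o a₁ a₂ v b = crossA'so p ends o a₁ a₂ v b := by
  unfold crossA'so
  rw [prob_update_zero_loop e p _ (update_loop_mem_iff hl a₂ {a₁}),
    prob_update_zero_loop e p _ (update_loop_mem_connEvent_iff hl a₁ v),
    prob_update_zero_loop e p _ (fun ω => by
      simp only [Set.mem_inter_iff, update_loop_mem_iff hl, update_loop_mem_connEvent_iff hl]),
    prob_update_zero_loop e p _ (fun ω => by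
      simp only [Set.mem_inter_iff, update_loop_mem_iff hl, update_loop_mem_connEvent_iff hl]),
    prob_update_zero_loop e p _ (fun ω => by
      simp only [Set.mem_inter_iff, update_loop_mem_iff hl, update_loop_mem_connEvent_iff hl]),
    prob_update_zero_loop e p _ (fun ω => by
      simp only [Set.mem_inter_iff, update_loop_mem_iff hl, update_loop_mem_connEvent_iff hl]),
    prob_update_zero_loop e p _ (fun ω => by
      simp only [Set.mem_inter_iff, update_loop_mem_iff hl, update_loop_mem_connEvent_iff hl])]

end Loop

end CrossAPrimeSupport

end Summit.Ventures.PercRepro2
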